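import Summits.CriticalPhenomena.SAWScalingLimit.Theorems.SAWRenewalTightnessEventualTightShellCountOfMultiShadow

/-!
# `EventualTight`, line `Sketch`, stub S2′ `stub_shellCountOfCleanMultiShadow`: confinement and
# the CLEAN CO-ORIENTED multi-strand shadowing atom give per-shell traversal-count tightness

Crux item `stmt-CriticalPhenomena-1372` (`SAWRenewalTightness.EventualTight`), line `Sketch`,
stub S2′.  This is the variant of the landed glue `stub_shellCountOfMultiShadow`
(`Theorems/SAWRenewalTightnessEventualTightShellCountOfMultiShadow.lean`) in which the atom
(hypothesis 2) is only asked to bound the probability of `j` separate traversal strands of the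
shell `D(x; r, R)` that are moreover

* CLEAN: strictly between its endpoint times each strand stays in the open annulus
  `r < dist · x < R`;
* CO-ORIENTED: either all `j` strands start in the closed inner disc, or all start outside the
  open outer disc;
* pairwise mutually `η`-shadowing and listed in increasing time order (as before).

Both extra normalisations are free on the deterministic side:

* (i) CLEANING `exists_clean_subtraversal`: a traversal `γ|[s, t]` contains a clean
  sub-traversal `γ|[s', t']`, `s ≤ s' ≤ t' ≤ t` — the last time in the closed inner disc followed
  by the first subsequent time outside the open outer disc (mirror construction for the other
  orientation), exactly the argument of `Curve.HasTraversals.makesCrossing`; nested intervals keep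
  an increasing separated family separated.
* (ii) CO-ORIENTATION `exists_strictMono_forall_or_forall_not`: among `2m` strands at least `m`
  start inside or at least `m` start outside (the two classes partition `Fin (2m)`); list `m` of one
  class increasingly (`Finset.orderEmbOfFin`).
* (iii) PIGEONHOLE `exists_strictMono_shadowing`: the hyperspace pigeonhole of the sibling file,
  re-proved in sub-family form — from ANY family of `2^{#T} · j + 1` parameter intervals (with `T`
  a finite `η/2`-net of the compact region) one extracts, by a strictly monotone re-indexing, `j`
  of them that pairwise `η`-shadow each other (`exists_dist_le_of_net_code_subset`); every
  pointwise property of the strands (traversal, cleanness, orientation) and the separation are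
  inherited along the re-indexing.
* (iv) ASSEMBLY `stub_shellCountOfCleanMultiShadow` as in the sibling: with `k = max (2 k₁) N`,
  `N` the Aizenman–Burchard coarse-mesh cutoff `stub_travCount` above the mesh floor `min δ₁ δc`,
  the event `{k traversals}` is contained in the atom's event for `δ ≤ min δ₁ δc` (confinement in
  `B̄(0, L)` + (i)–(iii)) and is empty for coarser meshes.

No definitions; tree vocabulary only.  Sources: M. Aizenman, A. Burchard, *Hölder regularity and
dimension bounds for random curves*, Duke Math. J. 99 (1999), §1.b (traversals, the remark after
(1.2) that a segment joining the two boundary components contains a sub-segment in the shell);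
the coding-by-a-net pigeonhole is standard. [folklore]
-/

noncomputable section

open MeasureTheory Filter Topology Set Metric
open scoped ENNReal NNReal unitInterval
open Literature.Probability.RandomPlanarGeometry Literature.Probability.LatticeModels

namespace Summit.CriticalPhenomena.SAWScalingLimit.Theorems

/-! ### (i) Cleaning a traversal -/

/-- **Every traversal contains a clean sub-traversal.**  If `γ|[s, t]` traverses the shell
`D(x; r, R)` (one endpoint in the closed inner disc, the other outside the open outer disc), then
for some `s ≤ s' ≤ t' ≤ t` the segment `γ|[s', t']` is again a traversal and at all times strictly
between `s'` and `t'` the curve lies in the open annulus `r < dist · x < R`: take the last time in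
the closed inner disc and then the first subsequent time outside the open outer disc (mirror
construction when the outer endpoint comes first).  (Aizenman–Burchard 1999, §1.b, remark after
(1.2); the argument of `Curve.HasTraversals.makesCrossing`.) [folklore] -/
theorem exists_clean_subtraversal {γ : Curve ℂ} {x : ℂ} {r R : ℝ} {s t : I}
    (h : γ.IsTraversal x r R s t) :
    ∃ s' t' : I, s ≤ s' ∧ t' ≤ t ∧ γ.IsTraversal x r R s' t' ∧
      ∀ u : I, s' < u → u < t' → r < dist (γ u) x ∧ dist (γ u) x < R := by
  obtain ⟨hle, hends⟩ := h
  have hfc : Continuous fun u : I => dist (γ u) x := γ.continuous.dist continuous_const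
  rcases hends with ⟨hin, hout⟩ | ⟨hout, hin⟩
  · -- inner endpoint first: last time `a ∈ [s, t]` in the inner disc, first exit `b ∈ [a, t]`
    have hA : IsClosed {u : I | u ∈ Icc s t ∧ dist (γ u) x ≤ r} :=
      isClosed_Icc.inter (isClosed_le hfc continuous_const)
    obtain ⟨a, ⟨⟨hsa, hat⟩, har⟩, hamax⟩ :=
      hA.isCompact.exists_isGreatest ⟨s, ⟨le_rfl, hle⟩, hin⟩
    have hB : IsClosed {u : I | u ∈ Icc a t ∧ R ≤ dist (γ u) x} :=
      isClosed_Icc.inter (isClosed_le continuous_const hfc)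
    obtain ⟨b, ⟨⟨hab, hbt⟩, hbR⟩, hbmin⟩ :=
      hB.isCompact.exists_isLeast ⟨t, ⟨hat, le_rfl⟩, hout⟩
    refine ⟨a, b, hsa, hbt, ⟨hab, Or.inl ⟨har, hbR⟩⟩, fun u hau hub => ⟨?_, ?_⟩⟩
    · -- `r < dist (γ u) x`: otherwise `u` would be a later time in the inner disc
      by_contra hle'
      have hu : dist (γ u) x ≤ r := not_lt.1 hle'
      exact absurd hau (not_lt.2 (hamax ⟨⟨hsa.trans hau.le, hub.le.trans hbt⟩, hu⟩))
    · -- `dist (γ u) x < R`: otherwise `u` would be an earlier exit time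
      by_contra hge
      have hu : R ≤ dist (γ u) x := not_lt.1 hge
      exact absurd hub (not_lt.2 (hbmin ⟨⟨hau.le, hub.le.trans hbt⟩, hu⟩))
  · -- outer endpoint first: first time `b ∈ [s, t]` in the inner disc, last `a ∈ [s, b]` outside
    have hB : IsClosed {u : I | u ∈ Icc s t ∧ dist (γ u) x ≤ r} :=
      isClosed_Icc.inter (isClosed_le hfc continuous_const)
    obtain ⟨b, ⟨⟨hsb, hbt⟩, hbr⟩, hbmin⟩ :=
      hB.isCompact.exists_isLeast ⟨t, ⟨hle, le_rfl⟩, hin⟩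
    have hA : IsClosed {u : I | u ∈ Icc s b ∧ R ≤ dist (γ u) x} :=
      isClosed_Icc.inter (isClosed_le continuous_const hfc)
    obtain ⟨a, ⟨⟨hsa, hab⟩, haR⟩, hamax⟩ :=
      hA.isCompact.exists_isGreatest ⟨s, ⟨le_rfl, hsb⟩, hout⟩
    refine ⟨a, b, hsa, hbt, ⟨hab, Or.inr ⟨haR, hbr⟩⟩, fun u hau hub => ⟨?_, ?_⟩⟩
    · by_contra hle'
      have hu : dist (γ u) x ≤ r := not_lt.1 hle'
      exact absurd hub (not_lt.2 (hbmin ⟨⟨hsa.trans hau.le, hub.le.trans hbt⟩, hu⟩))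
    · by_contra hge
      have hu : R ≤ dist (γ u) x := not_lt.1 hge
      exact absurd hau (not_lt.2 (hamax ⟨⟨hsa.trans hau.le, hub.le⟩, hu⟩))

/-! ### (ii) Increasing sub-families and co-orientation -/

/-- Listing `m` elements of a finite set of indices `F ⊆ Fin n` with `m ≤ #F` increasingly: a
strictly monotone `ψ : Fin m → Fin n` with values in `F` (`Finset.orderEmbOfFin` restricted along
`Fin.castLE`). [folklore] -/
theorem exists_strictMono_mem_of_le_card {n m : ℕ} (F : Finset (Fin n)) (hm : m ≤ F.card) :
    ∃ ψ : Fin m → Fin n, StrictMono ψ ∧ ∀ i, ψ i ∈ F :=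
  ⟨fun i => F.orderEmbOfFin rfl (Fin.castLE hm i), fun _ _ h =>
    (F.orderEmbOfFin rfl).strictMono ((Fin.castLE_lt_castLE_iff hm).2 h),
    fun _ => F.orderEmbOfFin_mem rfl _⟩

/-- **Co-orientation by majority.**  For any property `Q` of `2m` indices, some `m` of them, listed
increasingly, all satisfy `Q` or all fail `Q` (the two classes partition `Fin (2m)`, so one of
them has at least `m` elements). [folklore] -/
theorem exists_strictMono_forall_or_forall_not (m : ℕ) (Q : Fin (2 * m) → Prop) :
    ∃ ψ : Fin m → Fin (2 * m), StrictMono ψ ∧ ((∀ i, Q (ψ i)) ∨ ∀ i, ¬ Q (ψ i)) := by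
  classical
  have hsum := Finset.card_filter_add_card_filter_not (s := (Finset.univ : Finset (Fin (2 * m)))) Q
  rw [Finset.card_univ, Fintype.card_fin] at hsum
  by_cases hm : m ≤ (Finset.univ.filter Q).card
  · obtain ⟨ψ, hψ, hmem⟩ := exists_strictMono_mem_of_le_card _ hm
    exact ⟨ψ, hψ, Or.inl fun i => (Finset.mem_filter.1 (hmem i)).2⟩
  · have hm' : m ≤ (Finset.univ.filter fun i => ¬ Q i).card := by omega
    obtain ⟨ψ, hψ, hmem⟩ := exists_strictMono_mem_of_le_card _ hm'
    exact ⟨ψ, hψ, Or.inr fun i => (Finset.mem_filter.1 (hmem i)).2⟩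

/-! ### (iii) The hyperspace pigeonhole in sub-family form -/

/-- **Hyperspace pigeonhole, sub-family form.**  For a compact region `Λ`, a resolution `η > 0`
and a number of strands `j` there is `k` (namely `2^{#T} · j + 1` for a finite `η/2`-net `T` of
`Λ`) such that from ANY `k` parameter intervals `[s i, t i]` of a curve in `Λ` one can select `j`,
by a strictly monotone re-indexing `φ`, that are pairwise mutually `η`-shadowing: every point of
`γ|[s (φ i), t (φ i)]` is within `η` of a point of `γ|[s (φ i'), t (φ i')]`.  Proof: code each
interval by the set of net points its image comes `η/2`-close to
(`Finset.exists_lt_card_fiber_of_mul_lt_card_of_maps_to` gives a code with a fibre of more than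
`j` intervals; list `j` of them increasingly; equal codes shadow each other,
`exists_dist_le_of_net_code_subset`). [folklore] -/
theorem exists_strictMono_shadowing {Λ : Set ℂ} (hΛ : IsCompact Λ) {η : ℝ} (hη : 0 < η)
    (j : ℕ) :
    ∃ k : ℕ, ∀ γ : Curve ℂ, γ.range ⊆ Λ → ∀ s t : Fin k → I,
      ∃ φ : Fin j → Fin k, StrictMono φ ∧
        ∀ (i i' : Fin j) (u : I), s (φ i) ≤ u → u ≤ t (φ i) →
          ∃ v : I, s (φ i') ≤ v ∧ v ≤ t (φ i') ∧ dist (γ u) (γ v) ≤ η := by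
  obtain ⟨T, -, hTfin, hTcov⟩ := finite_cover_balls_of_compact hΛ (half_pos hη)
  classical
  obtain ⟨C, hC⟩ : ∃ C : ℕ, hTfin.toFinset.powerset.card = C := ⟨_, rfl⟩
  refine ⟨C * j + 1, fun γ hγΛ s t => ?_⟩
  have hcov : γ.range ⊆ ⋃ p ∈ T, Metric.ball p (η / 2) := hγΛ.trans hTcov
  -- the code of an interval: the net points its image comes `η/2`-close to
  let code : Fin (C * j + 1) → Finset ℂ := fun i =>
    hTfin.toFinset.filter (fun p => ∃ u : I, s i ≤ u ∧ u ≤ t i ∧ dist (γ u) p < η / 2)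
  have hmaps : ∀ i ∈ (Finset.univ : Finset (Fin (C * j + 1))),
      code i ∈ hTfin.toFinset.powerset := fun i _ =>
    Finset.mem_powerset.2 (Finset.filter_subset _ _)
  have hcard : hTfin.toFinset.powerset.card * j <
      (Finset.univ : Finset (Fin (C * j + 1))).card := by
    rw [Finset.card_univ, Fintype.card_fin, hC]
    exact Nat.lt_succ_self _
  -- a code with a fibre of more than `j` intervals
  obtain ⟨y, -, hy⟩ := Finset.exists_lt_card_fiber_of_mul_lt_card_of_maps_to hmaps hcard
  obtain ⟨F, hF, hjF⟩ : ∃ F : Finset (Fin (C * j + 1)), (∀ i ∈ F, code i = y) ∧ j < F.card :=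
    ⟨_, fun i hi => (Finset.mem_filter.1 hi).2, hy⟩
  -- list `j` intervals of the fibre increasingly
  obtain ⟨φ, hφmono, hφF⟩ := exists_strictMono_mem_of_le_card F hjF.le
  have hφcode : ∀ i, code (φ i) = y := fun i => hF _ (hφF i)
  -- equal codes shadow each other
  have close : ∀ {i i' : Fin (C * j + 1)}, code i = code i' →
      ∀ u : I, s i ≤ u → u ≤ t i → ∃ v : I, s i' ≤ v ∧ v ≤ t i' ∧ dist (γ u) (γ v) ≤ η := by
    intro i i' h u hsu hut
    refine exists_dist_le_of_net_code_subset hcov (fun p hpT hp => ?_) u hsu hut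
    have hpi : p ∈ code i := Finset.mem_filter.2 ⟨hTfin.mem_toFinset.2 hpT, hp⟩
    rw [h] at hpi
    exact (Finset.mem_filter.1 hpi).2
  exact ⟨φ, hφmono, fun i i' u hsu hut => close ((hφcode i).trans (hφcode i').symm) u hsu hut⟩

/-- **Clean co-oriented shadowing families from many traversals** (deterministic core of S2′).
For a compact region `Λ`, a shell `D(x; r, R)`, a resolution `η > 0` and a strand number `j` there
is `k` such that every curve in `Λ` with `k` separate traversals of the shell has `j` separate
traversal strands, listed in increasing time order, which are clean (interior in the open
annulus), co-oriented (all start in the closed inner disc, or all start outside the open outer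
disc) and pairwise mutually `η`-shadowing.  Proof: clean every traversal
(`exists_clean_subtraversal`), keep a co-oriented half (`exists_strictMono_forall_or_forall_not`),
then apply the hyperspace pigeonhole in sub-family form (`exists_strictMono_shadowing`); all
pointwise properties and the separation survive the strictly monotone re-indexings. [folklore] -/
theorem exists_cleanShadowingFamily_of_hasTraversals {Λ : Set ℂ} (hΛ : IsCompact Λ) (x : ℂ)
    (r R : ℝ) {η : ℝ} (hη : 0 < η) (j : ℕ) :
    ∃ k : ℕ, ∀ γ : Curve ℂ, γ.range ⊆ Λ → γ.HasTraversals k x r R →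
      ∃ s t : Fin j → I, (∀ i, γ.IsTraversal x r R (s i) (t i)) ∧
        ((∀ i, dist (γ (s i)) x ≤ r) ∨ (∀ i, R ≤ dist (γ (s i)) x)) ∧
        (∀ (i : Fin j) (u : I), s i < u → u < t i → r < dist (γ u) x ∧ dist (γ u) x < R) ∧
        (∀ ⦃i i' : Fin j⦄, i < i' → t i < s i') ∧
        ∀ (i i' : Fin j) (u : I), s i ≤ u → u ≤ t i →
          ∃ v : I, s i' ≤ v ∧ v ≤ t i' ∧ dist (γ u) (γ v) ≤ η := by
  obtain ⟨k₁, hk₁⟩ := exists_strictMono_shadowing hΛ hη j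
  refine ⟨2 * k₁, fun γ hγΛ hk => ?_⟩
  obtain ⟨s, t, hst, hsep⟩ := hk
  -- (i) cleaning
  choose s' t' hss' htt' hst' hclean using fun i => exists_clean_subtraversal (hst i)
  -- (ii) co-orientation
  obtain ⟨ψ, hψ, hor⟩ :=
    exists_strictMono_forall_or_forall_not k₁ fun i => dist (γ (s' i)) x ≤ r
  -- (iii) pigeonhole
  obtain ⟨φ, hφ, hshadow⟩ := hk₁ γ hγΛ (s' ∘ ψ) (t' ∘ ψ)
  refine ⟨s' ∘ ψ ∘ φ, t' ∘ ψ ∘ φ, fun i => hst' _, ?_, fun i u hu hu' => hclean _ u hu hu',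
    fun i i' h => ?_, fun i i' u hsu hut => hshadow i i' u hsu hut⟩
  · rcases hor with hQ | hQ
    · exact Or.inl fun i => hQ _
    · refine Or.inr fun i => ?_
      rcases (hst' (ψ (φ i))).2 with ⟨h1, -⟩ | ⟨h1, -⟩
      · exact absurd h1 (hQ _)
      · exact h1
  · -- separation survives: `t' ≤ t < s ≤ s'` along the strictly monotone `ψ ∘ φ`
    calc (t' ∘ ψ ∘ φ) i ≤ t (ψ (φ i)) := htt' _
      _ < s (ψ (φ i')) := hsep (hψ (hφ h))
      _ ≤ (s' ∘ ψ ∘ φ) i' := hss' _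

/-! ### The registered stub -/

/-- **S2′ `stub_shellCountOfCleanMultiShadow` (`ShellCountOfCleanMultiShadow` of the line
`Sketch`, with `Confinement`, the clean co-oriented multi-strand shadowing atom and
`ShellCountTight` unfolded).**  If for small meshes every critical SAW polyline of `Ω_δ` from `a_δ`
to `b_δ` lies in one compact disc `B̄(0, L)` (confinement), and for every genuine shell and `θ > 0`
some resolution `η > 0`, strand number `j` and mesh threshold `δ₁ > 0` make `j` clean, co-oriented,
pairwise mutually `η`-shadowing separate traversal strands `θ`-improbable for `δ ∈ (0, δ₁]` (the
atom), then for every genuine shell and `θ > 0` some `k` makes `k` separate traversals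
`θ`-improbable for all `δ ∈ (0, 1]`: for `δ ≤ min δ₁ δc` by
`exists_cleanShadowingFamily_of_hasTraversals` in `B̄(0, L)`, for coarser meshes because the event
is empty (`stub_travCount`, the Aizenman–Burchard short-distance cutoff, AB99 §1.a). [folklore] -/
theorem stub_shellCountOfCleanMultiShadow :
    (∀ (D : DobrushinDomain) (a b : ℝ → Site 2), SAW.IsEndpointApprox D a b →
      ∃ (L δ₀ : ℝ), 0 < δ₀ ∧ ∀ δ ∈ Set.Ioc (0 : ℝ) δ₀,
        ∀ γ : SAW.DomainSAW D.carrier δ (a δ) (b δ),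
          (⟨γ.walk.toCurve (meshPoint δ)⟩ : Curve ℂ).range ⊆ Metric.closedBall (0 : ℂ) L) →
    (∀ (D : DobrushinDomain) (a b : ℝ → Site 2), SAW.IsEndpointApprox D a b →
      ∀ (x : ℂ) (r R : ℝ), 0 < r → r < R → ∀ θ : ℝ, 0 < θ →
        ∃ η : ℝ, 0 < η ∧ ∃ (j : ℕ) (δ₁ : ℝ), 0 < δ₁ ∧ ∀ δ ∈ Set.Ioc (0 : ℝ) δ₁,
          SAW.law D.carrier δ (a δ) (b δ)
            {γ | ∃ s t : Fin j → unitInterval,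
              (∀ i, (⟨γ.walk.toCurve (meshPoint δ)⟩ : Curve ℂ).IsTraversal x r R (s i) (t i)) ∧
              ((∀ i, dist ((⟨γ.walk.toCurve (meshPoint δ)⟩ : Curve ℂ) (s i)) x ≤ r) ∨
                (∀ i, R ≤ dist ((⟨γ.walk.toCurve (meshPoint δ)⟩ : Curve ℂ) (s i)) x)) ∧
              (∀ (i : Fin j) (u : unitInterval), s i < u → u < t i →
                r < dist ((⟨γ.walk.toCurve (meshPoint δ)⟩ : Curve ℂ) u) x ∧
                  dist ((⟨γ.walk.toCurve (meshPoint δ)⟩ : Curve ℂ) u) x < R) ∧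
              (∀ ⦃i i' : Fin j⦄, i < i' → t i < s i') ∧
              ∀ (i i' : Fin j) (u : unitInterval), s i ≤ u → u ≤ t i →
                ∃ v : unitInterval, s i' ≤ v ∧ v ≤ t i' ∧
                  dist ((⟨γ.walk.toCurve (meshPoint δ)⟩ : Curve ℂ) u)
                    ((⟨γ.walk.toCurve (meshPoint δ)⟩ : Curve ℂ) v) ≤ η}
            ≤ ENNReal.ofReal θ) →
    ∀ (D : DobrushinDomain) (a b : ℝ → Site 2), SAW.IsEndpointApprox D a b →
      ∃ δ₀ : ℝ, 0 < δ₀ ∧ ∀ (x : ℂ) (ρ R : ℝ), 0 < ρ → ρ < R → ∀ η : ℝ, 0 < η →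
        ∃ k : ℕ, ∀ δ ∈ Set.Ioc (0 : ℝ) δ₀,
          SAW.law D.carrier δ (a δ) (b δ)
            {γ | (⟨γ.walk.toCurve (meshPoint δ)⟩ : Curve ℂ).HasTraversals k x ρ R}
            ≤ ENNReal.ofReal η := by
  intro hConf hAtom D a b hab
  obtain ⟨L, δc, hδc, hconf⟩ := hConf D a b hab
  refine ⟨1, one_pos, fun x ρ R hρ hρR θ hθ => ?_⟩
  obtain ⟨η, hη, j, δ₁, hδ₁, hbound⟩ := hAtom D a b hab x ρ R hρ hρR θ hθ
  -- (i)–(iii) the deterministic threshold in the confining disc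
  obtain ⟨k₁, hk₁⟩ :=
    exists_cleanShadowingFamily_of_hasTraversals (isCompact_closedBall (0 : ℂ) L) x ρ R hη j
  -- the coarse-mesh cutoff above the mesh floor `min δ₁ δc`
  obtain ⟨N, hN⟩ := stub_travCount ρ (min δ₁ δc) hρ (lt_min hδ₁ hδc)
  refine ⟨max k₁ N, fun δ hδ => ?_⟩
  by_cases hle : δ ≤ min δ₁ δc
  · -- fine meshes: `k` traversals ⊆ `j` clean co-oriented shadowing strands, probability `≤ θ`
    refine le_trans (measure_mono fun γ hγ => ?_) (hbound δ ⟨hδ.1, hle.trans (min_le_left _ _)⟩)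
    exact hk₁ _ (hconf δ ⟨hδ.1, hle.trans (min_le_right _ _)⟩ γ)
      (Curve.HasTraversals.of_le hγ (le_max_left _ _))
  · -- coarse meshes: the event is empty
    have hlt : min δ₁ δc < δ := lt_of_not_ge hle
    have hempty : {γ : SAW.DomainSAW D.carrier δ (a δ) (b δ) |
        (⟨γ.walk.toCurve (meshPoint δ)⟩ : Curve ℂ).HasTraversals (max k₁ N) x ρ R} = ∅ :=
      Set.eq_empty_of_forall_notMem fun γ hγ =>
        hN D.carrier δ (a δ) (b δ) γ x R hlt.le hρR
          (Curve.HasTraversals.of_le hγ (le_max_right _ _))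
    rw [hempty, measure_empty]
    exact zero_le

end Summit.CriticalPhenomena.SAWScalingLimit.Theorems

end
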